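import Literature.MathematicalPhysics.QuantumFieldTheory.Balaban1983to89.Node00.ZeroInputStepT
import Literature.MathematicalPhysics.QuantumFieldTheory.Balaban1983to89.Node00.BackgroundSelOfRecord
import Literature.MathematicalPhysics.QuantumFieldTheory.Balaban1983to89.Node00.SmallFieldChi29AxOfRecord
import Literature.MathematicalPhysics.QuantumFieldTheory.Balaban1983to89.T4ExpWindowSmallField

/-!
# NODE O port, row PT-A′ helper lane (PTZ-1, gen 2): the FIRST-LEVEL rows of the zero-input split — «no history at the first step»
# ([I] (0.17) p. 255, (0.21) p. 256 at k = 0; [II] p. 21), GENERIC: the transport `T`, the cut-off family `χ`, the radii `ε`, `ν`, `ε₁` are BOUND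

[Balaban1987RG1] = [I] (CMP 109, 1987): (0.17) p. 255 (the first step has the bare Wilson action as input), (0.21) p. 256 (`U_0(V) = V` on the
regularity class), (1.2) p. 260 (the classes `|U(∂p) − 1| < ε₀η²`), (1.6) p. 261, (2.9) p. 266 with the rider p. 266–267 («the variables at the bonds `b₀(c)`
… with the constant ε₁ replaced by O(ε₁)»); [Balaban1988Convergent] = [III] p. 265 L31–32 (threshold hierarchy).

Seat `ymgap-nodeO-port-PTZ-1` g2 (prover, HELPER MODE; `--supports stmt-QuantumFields-27930 --as helper`).  Continues gen 0's `…PortZDStepRows` ∕ `…PortZDFormatSplit`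
(✓p797663 ∕ ✓p797676): there, `PortZDSplit.formatPlusG_of_eventually_zero` records that a functional VANISHING near `0` has every format `E₀ ≥ 0` with the zero
pieces — the mould-level shape of the history-channel clause (L) of `PortZeroInputSplitZD` (26648) AT `k = 0`; and the tree's
`Node00.ZeroInput.dChannel_zero_at_first_level'` gives the vanishing `𝓝_1(W) = 𝓝⁰_1(W)` from two leaves: (h₁) «supp χ_0 ⊆ bgReg_0» and (h₂) «U_1(W) ∈ bgReg_0».
THIS FILE closes what is FREE of those two leaves, for ANY transport and cut-off family:
* §1 (h₂) IS FREE: `Uk_succ_mem_bgReg` — `U_{k+1}(W) ∈ bgReg_k` for EVERY coarse field `W` and radius `0 < ε` (on the solvable set the minimiser lies in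
  `bgReg_{k+1} ⊆ bgReg_k` since `η_{k+1} ≤ η_k`; off it the tree's `Uk` is the unit configuration, regular at every level); hence
  `dChannel_zero_at_first_level_of_supp` — the first-level identity from (h₁) ALONE — and its matrix-carrier form `mergedTermFamilyMatT_zero_eq_of_supp`
  (the species the record's `recordΦfAx ∕ recordΦzAx` read, `K0RecordFormatNames…Lemmas4.recordΦzAx_eq_expChart`): at `k = 0` the merged family and the
  zero-input family AGREE IDENTICALLY (every `K`, history `v`, matrix field `W`).
* §2 (h₁) FOR THE ALL-BONDS RE-CENTRED CUT-OFF: `mem_bgReg_zero_of_chiFix29AllAx_eq_one` — the threshold-hierarchy lemma of `Node00/SmallFieldChi29OfRecord` §3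
  in the `bgReg_0` edition for [Ax-2]'s `chiFix29AllAxOfRecord` (`|∂V − 1| ≤ |∂V^{(0)}_{ax} − 1| + Σ_{b⊂∂p}|V^{(0)}_{ax}(b)⁻¹V(b) − 1|`, the tree's
  `dist1_plaqHol_le_add` + `plaqDev_le_four_mul`), with the smallness of the block-axial critical configuration `V^{(0)}_{ax}(V̄) = axialize (U_1(V̄))`
  DISCHARGED on both branches (`plaqSmall_critCfgAxOfRecord_zero`: solvable ⇒ `U_1 ∈ bgReg_1`, `axialize` a gauge image; unsolvable ⇒ `axialize 1`, flat) —
  so `χ^{(2.9),all}_{0,ax}(V) = 1 ⟹ V ∈ bgReg_0(ε)` under the bare numeric ordering `ν.εreg·η_1² + 4ε₁ ≤ ε`; the PRINTED species `chiFix29AxOfRecord` (the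
  `b₀(c)`-variables unrestricted) gets the same conclusion under the p. 266–267 RIDER displayed as `hb0` (`mem_bgReg_zero_of_chiFix29Ax_eq_one`).
* §3 COROLLARY `dChannel_zero_at_first_level_allAx`: for the cut-off family `fun K g k => chiFix29AllAxOfRecord F N ν ε₁ K k` and ANY transport, `𝓝_1 = 𝓝⁰_1`
  IDENTICALLY under `0 < ν.εreg`, `0 < ε`, `ν.εreg·η_1² + 4ε₁ ≤ ε` — the `k = 0` instance of (L) in kernel for that species (zero pieces, every `E ≥ 0`).
LOCATED (said, not claimed): for the printed species the global inclusion «supp χ^{(2.9)}_{0,ax} ⊆ bgReg_0» is NOT expected (a configuration flat off one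
`b₀(c)` and central on it averages to a near-flat coarse field yet has a far plaquette); print restricts the `b₀(c)`-variables through the δ-functions of the
averaging constraint ON THE FIBRE (the rider), which the record's transport `TβOfRecord₁₃ = TcanOfRecord` reads almost everywhere and pointwise only on
`regSetOfRecord` — the discharge of (h₁) at the record is therefore fibre-wise + transport determinacy near `W = 1`, not this file's.

HONEST FRAMING.  Kernel-checked bookkeeping over the tree's definitions (monotonicity of the regularity classes in the level, the junk branch of `Uk`, the
group algebra of `dist1`); NOTHING of Bałaban's estimates is asserted, ported or discharged; the [B11] clauses `UkExists ∕ UniqueUkOrbit` are never asserted;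
26648 ∕ 27930⁸ SIGNED·OPEN (content-gated), 27931 under CLOSE HOLD, 27932 CLOSED; counts unmoved; finite 𝕋⁴ at fixed ε — NOT continuum ∕ OS ∕ Clay; the
Yang–Mills mass gap is NOT proved by any of this.  No `sorry`, no `def`, no `instance`, no `notation`; standard axioms.
-/

noncomputable section

namespace Summit.QuantumFields.YangMills.Theorems.PortZD

open Literature.MathematicalPhysics.QuantumFieldTheory.Balaban1983to89
open Literature.MathematicalPhysics.QuantumFieldTheory.Balaban1983to89.Node00
open Literature.MathematicalPhysics.QuantumFieldTheory.Balaban1983to89.T4Continuum (T4Family)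
open T4TiltOscillation (bdev)
open T4ExpWindowSmallField (plaqDev plaqDev_le_four_mul dist1_plaqHol_le_add)
open BlockAxialRepresentative (axialize axialize_def)

variable {F : T4Family} {N : ℕ} [NeZero N]

/-! ## §1. (h₂) is free: `U_{k+1}(W) ∈ bgReg_k` for every `W`; the first-level identity from (h₁) alone -/

/-- **The regularity classes decrease with the level**: `bgReg_{k+1}(ε) ⊆ bgReg_k(ε)` for `0 ≤ ε` (`ε·η_{k+1}² ≤ ε·η_k²` since `η_{k+1} = η_k∕L ≤ η_k`, `L ≥ 1`).
[cite: Balaban1987RG1, (1.2) p.260 (bookkeeping)] -/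
theorem bgReg_succ_subset_bgReg (K k : ℕ) {ε : ℝ} (hε : 0 ≤ ε) : bgReg F N K (k + 1) ε ⊆ bgReg F N K k ε := by
  intro U hU
  rw [mem_bgReg_iff] at hU ⊢
  have hL : (1 : ℝ) ≤ (F.P K).L := by exact_mod_cast (F.P K).hL.2.le
  have hη0 : 0 ≤ (F.P K).eta (k + 1) := by unfold Params.eta; positivity
  have hη : (F.P K).eta (k + 1) ≤ (F.P K).eta k := by
    unfold Params.eta
    exact pow_le_pow_of_le_one (inv_nonneg.2 (zero_le_one.trans hL)) (inv_le_one_of_one_le₀ hL) (Nat.le_succ k)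
  exact fun p => (hU p).trans_le (mul_le_mul_of_nonneg_left (pow_le_pow_left₀ hη0 hη 2) hε)

/-- **(h₂) OF THE FIRST-LEVEL IDENTITY IS FREE**: `U_{k+1}(W) ∈ bgReg_k(ε)` for EVERY coarse field `W` and radius `0 < ε` — on the solvable set the chosen
minimiser lies in `bgReg_{k+1} ⊆ bgReg_k` ((1.2) read at the next level), off it the tree's `Uk` is the unit configuration (`Uk_of_not`), regular at every level
(`one_mem_bgReg`). [cite: Balaban1987RG1, (0.21) p.256, (1.2) p.260 (bookkeeping)] -/
theorem Uk_succ_mem_bgReg (K k : ℕ) {ε : ℝ} (hε : 0 < ε) (W : GaugeField (F.P K) (k + 1) (SU N)) :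
    Uk F N K (k + 1) ε W ∈ bgReg F N K k ε := by
  classical
  by_cases h : UkExists F N K (k + 1) ε W
  · exact bgReg_succ_subset_bgReg K k hε.le (Uk_mem_bgReg h)
  · rw [Uk_of_not h]
    exact one_mem_bgReg K k hε

/-- **THE FIRST-LEVEL IDENTITY FROM (h₁) ALONE**: `𝓝_1(W) = 𝓝⁰_1(W)` for EVERY `W`, any transport `T` and any cut-off family `χ` whose level-0 member is supported
in the regularity class `bgReg_0(ε)`, `0 < ε` ((h₂) «`U_1(W) ∈ bgReg_0`» supplied by `Uk_succ_mem_bgReg`). [cite: Balaban1987RG1, (0.17) p.255, (0.21) p.256 (bookkeeping)] -/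
theorem dChannel_zero_at_first_level_of_supp (T : Transport F N) (χ : (K : ℕ) → (ℕ → ℝ) → (k : ℕ) → Density (F.P K) k (SU N)) {ε : ℝ}
    (hε : 0 < ε) (K : ℕ) (g : ℕ → ℝ) (hχ : ∀ V : GaugeField (F.P K) 0 (SU N), χ K g 0 V ≠ 0 → V ∈ bgReg F N K 0 ε)
    (W : GaugeField (F.P K) 1 (SU N)) :
    mergedTermT F N T χ ε K g 0 W = ZeroInput.zeroInputMergedTermT F N T χ ε K g 0 W :=
  ZeroInput.dChannel_zero_at_first_level' F N T χ ε K g W hχ (Uk_succ_mem_bgReg K 0 hε W)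

/-- **MATRIX-CARRIER FORM** (the species `recordΦf ∕ recordΦfAx ∕ recordΦzAx` read): at `k = 0` the merged family and the zero-input family AGREE IDENTICALLY —
every torus index `K`, history `v`, matrix field `W` — as soon as the level-0 cut-off (at the clamped history `extd v`) is supported in `bgReg_0(ε)`, `0 < ε`.
[cite: Balaban1987RG1, (0.17) p.255, (1.20) p.264 (bookkeeping)] -/
theorem mergedTermFamilyMatT_zero_eq_of_supp (T : Transport F N) (χ : (K : ℕ) → (ℕ → ℝ) → (k : ℕ) → Density (F.P K) k (SU N)) {ε : ℝ}
    (hε : 0 < ε) (v : Fin 1 → ℝ) (K : ℕ)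
    (hχ : ∀ V : GaugeField (F.P K) 0 (SU N), χ K (T4FlagMemory.extd v) 0 V ≠ 0 → V ∈ bgReg F N K 0 ε)
    (W : Fin (F.P K).d → Site (F.P K) 1 → Matrix (Fin N) (Fin N) ℂ) :
    mergedTermFamilyMatT F N T χ ε 0 v K W = ZeroInput.zeroInputMergedTermFamilyMatT F N T χ ε 0 v K W :=
  dChannel_zero_at_first_level_of_supp T χ hε K _ hχ _

/-- The same for a COUPLING-BLIND cut-off family (every (2.9)-keyed species of record is, `chiFixed29Ax_flowBlind`): one support hypothesis at ANY history serves all.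
[cite: Balaban1987RG1, (0.17) p.255, (2.9) p.266 (bookkeeping)] -/
theorem mergedTermFamilyMatT_zero_eq_of_supp_flowBlind (T : Transport F N) (χ : (K : ℕ) → (ℕ → ℝ) → (k : ℕ) → Density (F.P K) k (SU N))
    (hblind : ∀ K (g g' : ℕ → ℝ), χ K g = χ K g') {ε : ℝ} (hε : 0 < ε) (K : ℕ) (g₀ : ℕ → ℝ)
    (hχ : ∀ V : GaugeField (F.P K) 0 (SU N), χ K g₀ 0 V ≠ 0 → V ∈ bgReg F N K 0 ε) (v : Fin 1 → ℝ)
    (W : Fin (F.P K).d → Site (F.P K) 1 → Matrix (Fin N) (Fin N) ℂ) :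
    mergedTermFamilyMatT F N T χ ε 0 v K W = ZeroInput.zeroInputMergedTermFamilyMatT F N T χ ε 0 v K W :=
  mergedTermFamilyMatT_zero_eq_of_supp T χ hε v K (fun V hV => hχ V (by rwa [hblind K g₀ (T4FlagMemory.extd v)])) W

/-! ## §2. (h₁) for the re-centred (2.9) cut-offs at level 0: the threshold-hierarchy lemma, `bgReg_0` edition -/

/-- **THE BLOCK-AXIAL CRITICAL CONFIGURATION AT LEVEL 0 IS REGULAR** — `V^{(0)}_{ax}(W) = axialize (U_1(W))` has `δ`-small plaquettes for every `δ` with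
`ν.εreg·η_1² ≤ δ` and `0 < δ`: on the solvable set `U_1(W) ∈ bgReg_1(ν.εreg)` (`Uk_mem_bgReg`) and `axialize` is a gauge image (`plaqSmall_gaugeAct_iff`); off it
`U_1(W) = 1` and `axialize 1` is a gauge image of the flat configuration. [cite: Balaban1987RG1, (2.3) p.265, (1.2) p.260 (bookkeeping)] -/
theorem plaqSmall_critCfgAxOfRecord_zero (ν : Stage7Numerics) (K : ℕ) {δ : ℝ} (hδ : 0 < δ) (hle : ν.εreg * (F.P K).eta 1 ^ 2 ≤ δ)
    (W : GaugeField (F.P K) 1 (SU N)) : PlaqSmall δ (critCfgAxOfRecord F N ν K 0 W) := by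
  classical
  rw [critCfgAxOfRecord_def, axialize_def, B12GaugeOrbits021.plaqSmall_gaugeAct_iff', critCfgOfRecord_def]
  show PlaqSmall δ (Uk F N K 1 ν.εreg W)
  by_cases h : UkExists F N K 1 ν.εreg W
  · have hreg := Uk_mem_bgReg h
    rw [mem_bgReg_iff] at hreg
    exact fun p => (hreg p).trans_le hle
  · rw [Uk_of_not h]
    have h1 := one_mem_bgReg (F := F) (N := N) K 0 hδ
    rw [mem_bgReg_iff] at h1
    intro p
    have := h1 p
    simpa [Params.eta] using this

/-- **THRESHOLD HIERARCHY, `bgReg_0` EDITION, ALL-BONDS SPECIES**: if every fluctuation variable of the level-0 field `V` about the block-axial critical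
configuration over `V̄` is `ε₁`-small (`χ^{(2.9),all}_{0,ax}(V) = 1`) and the thresholds are ordered, `ν.εreg·η_1² + 4ε₁ ≤ ε` with `0 < ν.εreg`, then `V` is REGULAR:
`V ∈ bgReg_0(ε)` (`|∂V − 1| ≤ |∂V^{(0)}_{ax} − 1| + Σ_{b⊂∂p}|V^{(0)}_{ax}(b)⁻¹V(b) − 1| < ν.εreg·η_1² + 4ε₁`).
[cite: Balaban1987RG1, (2.9) p.266, (1.2) p.260; Balaban1988Convergent, p.265] -/
theorem mem_bgReg_zero_of_chiFix29AllAx_eq_one {ν : Stage7Numerics} (hreg : 0 < ν.εreg) {ε₁ ε : ℝ} {K : ℕ}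
    (hord : ν.εreg * (F.P K).eta 1 ^ 2 + 4 * ε₁ ≤ ε) {V : GaugeField (F.P K) 0 (SU N)}
    (hχ : chiFix29AllAxOfRecord F N ν ε₁ K 0 V = 1) : V ∈ bgReg F N K 0 ε := by
  rw [mem_bgReg_iff]
  intro p
  set V₀ := critCfgAxOfRecord F N ν K 0 ((avOfRecord F N K 0).avg V)
  have hb : ∀ b, dist1 (bdev V V₀ b) ≤ ε₁ := fun b => le_of_lt ((chiFix29AllAxOfRecord_eq_one_iff ν ε₁ K 0 V).1 hχ b)
  have hδ : 0 < ν.εreg * (F.P K).eta 1 ^ 2 := by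
    have hη : 0 < (F.P K).eta 1 := by
      have hL : (0 : ℝ) < (F.P K).L := by exact_mod_cast (F.P K).L_pos
      unfold Params.eta; positivity
    positivity
  have hcrit : PlaqSmall (ν.εreg * (F.P K).eta 1 ^ 2) V₀ := plaqSmall_critCfgAxOfRecord_zero ν K hδ le_rfl _
  have h0 : (F.P K).eta 0 = 1 := by simp [Params.eta]
  calc dist1 (GaugeField.plaqHol V p) ≤ dist1 (GaugeField.plaqHol V₀ p) + plaqDev V V₀ p := dist1_plaqHol_le_add V V₀ p
    _ < ν.εreg * (F.P K).eta 1 ^ 2 + 4 * ε₁ := add_lt_add_of_lt_of_le (hcrit p) (plaqDev_le_four_mul hb p)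
    _ ≤ ε * (F.P K).eta 0 ^ 2 := by rw [h0, one_pow, mul_one]; exact hord

/-- **PRINTED SPECIES, MODULO THE p. 266–267 RIDER**: with (2.9) as printed (the `b₀(c)`-variables unrestricted by the cut-off) the same conclusion holds once
the excluded variables obey the induced restriction «with the constant ε₁ replaced by O(ε₁)» — a DISPLAYED hypothesis `hb0` (in print a consequence of the
averaging constraint on the fibre) — and `ν.εreg·η_1² + 4·max(ε₁, ε₁′) ≤ ε`. [cite: Balaban1987RG1, (2.9) p.266 and p.267] -/
theorem mem_bgReg_zero_of_chiFix29Ax_eq_one {ν : Stage7Numerics} (hreg : 0 < ν.εreg) {ε₁ ε₁' ε : ℝ} {K : ℕ}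
    (hord : ν.εreg * (F.P K).eta 1 ^ 2 + 4 * max ε₁ ε₁' ≤ ε) {V : GaugeField (F.P K) 0 (SU N)}
    (hχ : chiFix29AxOfRecord F N ν ε₁ K 0 V = 1)
    (hb0 : ∀ b : PBond (F.P K) 0, IsB0 b → fluctDevAxOfRecord F N ν K 0 V b ≤ ε₁') : V ∈ bgReg F N K 0 ε := by
  rw [mem_bgReg_iff]
  intro p
  set V₀ := critCfgAxOfRecord F N ν K 0 ((avOfRecord F N K 0).avg V)
  have hb : ∀ b, dist1 (bdev V V₀ b) ≤ max ε₁ ε₁' := by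
    intro b
    by_cases hB : IsB0 b
    · exact (hb0 b hB).trans (le_max_right _ _)
    · exact (le_of_lt ((chiFix29AxOfRecord_eq_one_iff ν ε₁ K 0 V).1 hχ b hB)).trans (le_max_left _ _)
  have hδ : 0 < ν.εreg * (F.P K).eta 1 ^ 2 := by
    have hη : 0 < (F.P K).eta 1 := by
      have hL : (0 : ℝ) < (F.P K).L := by exact_mod_cast (F.P K).L_pos
      unfold Params.eta; positivity
    positivity
  have hcrit : PlaqSmall (ν.εreg * (F.P K).eta 1 ^ 2) V₀ := plaqSmall_critCfgAxOfRecord_zero ν K hδ le_rfl _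
  have h0 : (F.P K).eta 0 = 1 := by simp [Params.eta]
  calc dist1 (GaugeField.plaqHol V p) ≤ dist1 (GaugeField.plaqHol V₀ p) + plaqDev V V₀ p := dist1_plaqHol_le_add V V₀ p
    _ < ν.εreg * (F.P K).eta 1 ^ 2 + 4 * max ε₁ ε₁' := add_lt_add_of_lt_of_le (hcrit p) (plaqDev_le_four_mul hb p)
    _ ≤ ε * (F.P K).eta 0 ^ 2 := by rw [h0, one_pow, mul_one]; exact hord

/-- (h₁) in the SHAPE `dChannel_zero_at_first_level'` consumes, for the all-bonds re-centred family `fun K g k => χ^{(2.9),all}_{k,ax}` (the cut-off takes only the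
values `0`, `1`). [cite: Balaban1987RG1, (2.9) p.266, (1.2) p.260 (bookkeeping)] -/
theorem supp_chiFix29AllAx_zero_subset_bgReg {ν : Stage7Numerics} (hreg : 0 < ν.εreg) {ε₁ ε : ℝ} {K : ℕ}
    (hord : ν.εreg * (F.P K).eta 1 ^ 2 + 4 * ε₁ ≤ ε) (V : GaugeField (F.P K) 0 (SU N))
    (hV : chiFix29AllAxOfRecord F N ν ε₁ K 0 V ≠ 0) : V ∈ bgReg F N K 0 ε := by
  classical
  have h1 : chiFix29AllAxOfRecord F N ν ε₁ K 0 V = 1 := by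
    unfold chiFix29AllAxOfRecord at hV ⊢
    split_ifs at hV ⊢ with h
    · rfl
    · exact absurd rfl hV
  exact mem_bgReg_zero_of_chiFix29AllAx_eq_one hreg hord h1

/-! ## §3. Corollary: the first-level identity for the all-bonds re-centred cut-off, any transport -/

/-- **`𝓝_1 = 𝓝⁰_1` IDENTICALLY for the ALL-BONDS re-centred cut-off and ANY transport** — the `k = 0` instance of the history-channel clause (L) in kernel for
that species (the difference functional is the zero functional; with `PortZDSplit.formatPlusG_of_eventually_zero` every format `E ≥ 0`), under the bare numeric
ordering of the radii. [cite: Balaban1987RG1, (0.17) p.255, (2.9) p.266; Balaban1988RG2Cluster, p.21] -/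
theorem dChannel_zero_at_first_level_allAx (T : Transport F N) (ν : Stage7Numerics) (hreg : 0 < ν.εreg) {ε₁ ε : ℝ} (hε : 0 < ε) (K : ℕ)
    (hord : ν.εreg * (F.P K).eta 1 ^ 2 + 4 * ε₁ ≤ ε) (g : ℕ → ℝ) (W : GaugeField (F.P K) 1 (SU N)) :
    mergedTermT F N T (fun K _ k => chiFix29AllAxOfRecord F N ν ε₁ K k) ε K g 0 W =
      ZeroInput.zeroInputMergedTermT F N T (fun K _ k => chiFix29AllAxOfRecord F N ν ε₁ K k) ε K g 0 W :=
  dChannel_zero_at_first_level_of_supp T _ hε K g (fun V hV => supp_chiFix29AllAx_zero_subset_bgReg hreg hord V hV) W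

/-- … and in the matrix-carrier form (every `K`, history `v`, matrix field `W`). [cite: Balaban1987RG1, (0.17) p.255, (1.20) p.264 (bookkeeping)] -/
theorem mergedTermFamilyMatT_zero_eq_allAx (T : Transport F N) (ν : Stage7Numerics) (hreg : 0 < ν.εreg) {ε₁ ε : ℝ} (hε : 0 < ε) (K : ℕ)
    (hord : ν.εreg * (F.P K).eta 1 ^ 2 + 4 * ε₁ ≤ ε) (v : Fin 1 → ℝ) (W : Fin (F.P K).d → Site (F.P K) 1 → Matrix (Fin N) (Fin N) ℂ) :
    mergedTermFamilyMatT F N T (fun K _ k => chiFix29AllAxOfRecord F N ν ε₁ K k) ε 0 v K W =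
      ZeroInput.zeroInputMergedTermFamilyMatT F N T (fun K _ k => chiFix29AllAxOfRecord F N ν ε₁ K k) ε 0 v K W :=
  mergedTermFamilyMatT_zero_eq_of_supp T _ hε v K (fun V hV => supp_chiFix29AllAx_zero_subset_bgReg hreg hord V hV) W

end Summit.QuantumFields.YangMills.Theorems.PortZD

end
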